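import Summits.SmoothPoincare4.SmoothPoincare4.Theorems.SymplecticOrigamiOrigamiFoldExistenceStubOuterCleanRecognitionChartCreaseRule

/-!
# Stub `stub_outerCleanRecognitionOfSide` of line `shadow-pleats` for crux `OrigamiFoldExistence` — Q:
# the STRUCTURE MAP `Ψ : M → S⁴` (item stmt-SmoothPoincare4-7844, route SymplecticOrigami; seat c4, lead)

File Q of the cut-at-`R` construction of `stub_outerCleanRecognitionOfSide` (skeleton r8,
`Cruxes/OrigamiFoldExistence/Lines/shadow_pleats.lean`).  For a `1`-chart pleated round-rim position
`(ι, δ, e)` of a compact `M` and a CAP MAP `C : ℝ⁵ → S⁴` (abstract here; file N `…ChartCapMap` supplies it)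
the structure map is

  `psiMap ι δ C m = C (ι m)` if `h(m) = ι m 4 ≤ 1 - δ`,  `= λ (proj5 (ι m))` otherwise (`λ = liftS4`).

Everything is proved UNDER EXPLICIT HYPOTHESES on `C` (smooth where `p₄ < 1`; equal to `λ ∘ proj5` on the band
`{(1-δ)/2 ≤ p₄ < 1}` of the round sphere; injective on the cap `{‖p‖ = 1, p₄ ≤ 1 - δ}` with image
`S⁴ ∖ λ(B_ρ)`; differential injective on tangent directions at cap points) and on the SHEET COUNT of the outer part
(file L `…ChartStructure`: the shadow is injective on `P̄⁺ = outerPartK`, maps it onto `B̄_ρ ∖ chimney4`, strictly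
above the plane into the open ball `B_ρ`, and `chimney4 ⊆ B_ρ`), so that this file waits for neither:

* `psiMap_eq_liftS4_of_lt` — on the open piece `{h > (1-δ)/2}` the structure map is `λ ∘ proj5 ∘ ι`;
* `contMDiff_psiMap` — it is `C^∞` on `M`;
* `injOn_psiMap` — it is injective on `K_R = M ∖ e 0 (B_R)` (`2 ≤ R`);
* `injective_mfderiv_psiMap` — it has injective differential at every point of `K_R` (`2 < R`);
* `image_psiMap` — `Ψ(K_R) = (chimney ∪ λ(G({2 ≤ ‖u‖ < R})))ᶜ`, the complement of the lifted cut region of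
  file P1.

Sources: the S6 assembly `…StubPleatFreeStandard.lean` (pattern: `straighten`), Lee, *Introduction to Smooth
Manifolds* (2013) Thm. 4.5; skeleton r8 docstring of `stub_outerCleanRecognitionOfSide`.
-/

noncomputable section

-- the prescribed namespace `Summit.<P>.<Sub>.…` duplicates `SmoothPoincare4` (P = Sub)
set_option linter.dupNamespace false

open scoped Manifold ContDiff Topology RealInnerProductSpace
open Set Function Filter Metric
open Literature.Topology.FourManifolds Literature.Topology.FourManifolds.SphereHypersurfaceSides

namespace Summit.SmoothPoincare4.SmoothPoincare4.Theorems.OrigamiFoldExistence.ShadowPleats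

section Psi

variable {M : Type} [TopologicalSpace M] [ChartedSpace (EuclideanSpace ℝ (Fin 4)) M]
  {ι : M → EuclideanSpace ℝ (Fin 5)} {δ : ℝ}

/-- The STRUCTURE MAP of a pleated position with cap map `C`: the cap map on and below the plane
`h = 1 - δ`, the lifted shadow above it. -/
def psiMap (ι : M → EuclideanSpace ℝ (Fin 5)) (δ : ℝ)
    (C : EuclideanSpace ℝ (Fin 5) → Metric.sphere (0 : EuclideanSpace ℝ (Fin 5)) 1) (m : M) :
    Metric.sphere (0 : EuclideanSpace ℝ (Fin 5)) 1 :=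
  if ι m 4 ≤ 1 - δ then C (ι m) else liftS4 (proj5 (ι m))

variable {C : EuclideanSpace ℝ (Fin 5) → Metric.sphere (0 : EuclideanSpace ℝ (Fin 5)) 1}

omit [TopologicalSpace M] [ChartedSpace (EuclideanSpace ℝ (Fin 4)) M] in
/-- On and below the plane the structure map is the cap map. -/
theorem psiMap_of_le {m : M} (hm : ι m 4 ≤ 1 - δ) : psiMap ι δ C m = C (ι m) := by
  simp [psiMap, hm]

omit [TopologicalSpace M] [ChartedSpace (EuclideanSpace ℝ (Fin 4)) M] in
/-- Strictly above the plane the structure map is the lifted shadow. -/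
theorem psiMap_of_lt {m : M} (hm : 1 - δ < ι m 4) : psiMap ι δ C m = liftS4 (proj5 (ι m)) := by
  simp [psiMap, not_le.2 hm]

omit [TopologicalSpace M] [ChartedSpace (EuclideanSpace ℝ (Fin 4)) M] in
/-- **On the open piece `{h > (1-δ)/2}` the structure map is the lifted shadow** (above the plane by
definition; on the band because the cap map is `λ ∘ proj5` there and `ι` is round). -/
theorem psiMap_eq_liftS4_of_lt
    (hround : Set.range ι ∩ {p : EuclideanSpace ℝ (Fin 5) | p 4 ≤ 1 - δ} =
      (Metric.sphere (0 : EuclideanSpace ℝ (Fin 5)) 1 : Set (EuclideanSpace ℝ (Fin 5))) ∩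
        {p : EuclideanSpace ℝ (Fin 5) | p 4 ≤ 1 - δ})
    (hCband : ∀ p : EuclideanSpace ℝ (Fin 5), ‖p‖ = 1 → (1 - δ) / 2 ≤ p 4 → p 4 < 1 →
      C p = liftS4 (proj5 p))
    (hδ : 0 < δ) {m : M} (hm : (1 - δ) / 2 < ι m 4) : psiMap ι δ C m = liftS4 (proj5 (ι m)) := by
  by_cases hle : ι m 4 ≤ 1 - δ
  · rw [psiMap_of_le hle]
    have hs : ‖ι m‖ = 1 := by simpa using mem_sphere_of_apply_le hround hle
    exact hCband _ hs hm.le (by linarith)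
  · exact psiMap_of_lt (not_le.1 hle)

/-- **The structure map is smooth**: on the open piece `{h < 1 - δ}` it is `C ∘ ι` (the cap map is smooth
where `p₄ < 1`), on the open piece `{h > (1-δ)/2}` it is `λ ∘ proj5 ∘ ι`, and the two pieces cover `M`. -/
theorem contMDiff_psiMap (hι : Manifold.IsSmoothEmbedding (𝓡 4) (𝓡 5) ∞ ι) (hδ : 0 < δ) (hδ1 : δ < 1)
    (hround : Set.range ι ∩ {p : EuclideanSpace ℝ (Fin 5) | p 4 ≤ 1 - δ} =
      (Metric.sphere (0 : EuclideanSpace ℝ (Fin 5)) 1 : Set (EuclideanSpace ℝ (Fin 5))) ∩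
        {p : EuclideanSpace ℝ (Fin 5) | p 4 ≤ 1 - δ})
    (hCs : ∀ p : EuclideanSpace ℝ (Fin 5), p 4 < 1 →
      ContMDiffAt 𝓘(ℝ, EuclideanSpace ℝ (Fin 5)) (𝓡 4) ∞ C p)
    (hCband : ∀ p : EuclideanSpace ℝ (Fin 5), ‖p‖ = 1 → (1 - δ) / 2 ≤ p 4 → p 4 < 1 →
      C p = liftS4 (proj5 p)) :
    ContMDiff (𝓡 4) (𝓡 4) ∞ (psiMap ι δ C) := by
  intro m
  by_cases hm : (1 - δ) / 2 < ι m 4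
  · have hopen : IsOpen {m' : M | (1 - δ) / 2 < ι m' 4} := isOpen_lt continuous_const (continuous_height hι)
    have hev : psiMap ι δ C =ᶠ[𝓝 m] liftS4 ∘ proj5 ∘ ι :=
      Filter.eventually_of_mem (hopen.mem_nhds hm) fun m' hm' =>
        psiMap_eq_liftS4_of_lt hround hCband hδ hm'
    refine ContMDiffAt.congr_of_eventuallyEq ?_ hev
    exact (contMDiff_liftS4.comp (contMDiff_shadow hι)) m
  · have hlt : ι m 4 < 1 - δ := by linarith [not_lt.1 hm]
    have hopen : IsOpen {m' : M | ι m' 4 < 1 - δ} := isOpen_lt (continuous_height hι) continuous_const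
    have hev : psiMap ι δ C =ᶠ[𝓝 m] C ∘ ι :=
      Filter.eventually_of_mem (hopen.mem_nhds hlt) fun m' hm' => psiMap_of_le (le_of_lt hm')
    refine ContMDiffAt.congr_of_eventuallyEq ?_ hev
    exact (hCs (ι m) (by linarith)).comp m (hι.contMDiff m)

/-! ### Injectivity and image on `K_R = M ∖ e 0 (B_R)` (sheet count + cap map) -/

omit [TopologicalSpace M] [ChartedSpace (EuclideanSpace ℝ (Fin 4)) M] in
/-- A point off the open chart ball of radius `R ≥ 2` and on or above the plane is in the closed outer part. -/
theorem mem_outerPartK_of_not_mem {e : Fin 1 → EuclideanSpace ℝ (Fin 4) → M} {R : ℝ} (hR : 2 ≤ R)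
    {m : M} (hm : m ∉ e 0 '' Metric.ball 0 R) (hle : 1 - δ ≤ ι m 4) : m ∈ outerPartK ι δ (e 0) := by
  refine ⟨hle, ?_⟩
  rintro ⟨u, hu, rfl⟩
  exact hm ⟨u, Metric.ball_subset_ball hR hu, rfl⟩

/-- **The structure map is injective on `K_R = M ∖ e 0 (B_R)`** (`R ≥ 2`): below the plane the cap map is
injective and `ι` is; above it the shadow is injective on the closed outer part (sheet count); and a point on
or below the plane goes to `S⁴ ∖ λ(B_ρ)` while a point above it goes into `λ(B_ρ)`. -/
theorem injOn_psiMap (hι : Manifold.IsSmoothEmbedding (𝓡 4) (𝓡 5) ∞ ι)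
    (hround : Set.range ι ∩ {p : EuclideanSpace ℝ (Fin 5) | p 4 ≤ 1 - δ} =
      (Metric.sphere (0 : EuclideanSpace ℝ (Fin 5)) 1 : Set (EuclideanSpace ℝ (Fin 5))) ∩
        {p : EuclideanSpace ℝ (Fin 5) | p 4 ≤ 1 - δ})
    {e : Fin 1 → EuclideanSpace ℝ (Fin 4) → M}
    (hinjK : InjOn (proj5 ∘ ι) (outerPartK ι δ (e 0)))
    (hlt : ∀ m ∈ outerPartK ι δ (e 0), 1 - δ < ι m 4 → ‖proj5 (ι m)‖ < Real.sqrt (1 - (1 - δ) ^ 2))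
    (hCinj : InjOn C {q : EuclideanSpace ℝ (Fin 5) | ‖q‖ = 1 ∧ q 4 ≤ 1 - δ})
    (hCim : C '' {q : EuclideanSpace ℝ (Fin 5) | ‖q‖ = 1 ∧ q 4 ≤ 1 - δ} =
      (liftS4 '' Metric.ball 0 (Real.sqrt (1 - (1 - δ) ^ 2)))ᶜ)
    {R : ℝ} (hR : 2 ≤ R) :
    InjOn (psiMap ι δ C) {m | m ∉ e 0 '' Metric.ball 0 R} := by
  -- a cap point goes to the complement of `λ(B_ρ)`, a point above the plane into `λ(B_ρ)`
  have hcap : ∀ m : M, ι m 4 ≤ 1 - δ →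
      psiMap ι δ C m ∈ (liftS4 '' Metric.ball 0 (Real.sqrt (1 - (1 - δ) ^ 2)))ᶜ := fun m hm => by
    rw [psiMap_of_le hm, ← hCim]
    exact mem_image_of_mem C ⟨by simpa using mem_sphere_of_apply_le hround hm, hm⟩
  have hup : ∀ m : M, m ∉ e 0 '' Metric.ball 0 R → 1 - δ < ι m 4 →
      psiMap ι δ C m ∈ liftS4 '' Metric.ball 0 (Real.sqrt (1 - (1 - δ) ^ 2)) := fun m hm hgt => by
    rw [psiMap_of_lt hgt]
    exact mem_image_of_mem liftS4 (mem_ball_zero_iff.2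
      (hlt m (mem_outerPartK_of_not_mem hR hm hgt.le) hgt))
  intro a ha b hb hab
  by_cases ha' : ι a 4 ≤ 1 - δ <;> by_cases hb' : ι b 4 ≤ 1 - δ
  · rw [psiMap_of_le ha', psiMap_of_le hb'] at hab
    have hsa : ‖ι a‖ = 1 := by simpa using mem_sphere_of_apply_le hround ha'
    have hsb : ‖ι b‖ = 1 := by simpa using mem_sphere_of_apply_le hround hb'
    exact hι.isEmbedding.injective (hCinj ⟨hsa, ha'⟩ ⟨hsb, hb'⟩ hab)
  · exact absurd (hab ▸ hcap a ha') (not_notMem.2 (hup b hb (not_le.1 hb')))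
  · exact absurd (hab ▸ hup a ha (not_le.1 ha')) (hcap b hb')
  · rw [psiMap_of_lt (not_le.1 ha'), psiMap_of_lt (not_le.1 hb')] at hab
    exact hinjK (mem_outerPartK_of_not_mem hR ha (not_le.1 ha').le)
      (mem_outerPartK_of_not_mem hR hb (not_le.1 hb').le) (liftS4_injective hab)

omit [TopologicalSpace M] [ChartedSpace (EuclideanSpace ℝ (Fin 4)) M] in
/-- **The image of `K_R` under the structure map is the complement of the lifted cut region**
`chimney ∪ λ(G({2 ≤ ‖u‖ < R}))` (`G = proj5 ∘ ι ∘ e 0`; file P1's `liftedCut D R`): the cap goes onto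
`S⁴ ∖ λ(B_ρ)`, the closed outer part minus the half-open cut collar onto `λ(B_ρ ∖ (chimney4 ∪ G({2 ≤ ‖u‖ < R})))`,
and `chimney4 ∪ G({2 ≤ ‖u‖ < R}) ⊆ B_ρ`. -/
theorem image_psiMap
    (hround : Set.range ι ∩ {p : EuclideanSpace ℝ (Fin 5) | p 4 ≤ 1 - δ} =
      (Metric.sphere (0 : EuclideanSpace ℝ (Fin 5)) 1 : Set (EuclideanSpace ℝ (Fin 5))) ∩
        {p : EuclideanSpace ℝ (Fin 5) | p 4 ≤ 1 - δ})
    {e : Fin 1 → EuclideanSpace ℝ (Fin 4) → M} {D : TubeData (liftedCrease ι (e 0))}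
    (he : Injective (e 0)) (hchart : ∀ u, 1 - δ < ι (e 0 u) 4)
    (hinjK : InjOn (proj5 ∘ ι) (outerPartK ι δ (e 0)))
    (hlt : ∀ m ∈ outerPartK ι δ (e 0), 1 - δ < ι m 4 → ‖proj5 (ι m)‖ < Real.sqrt (1 - (1 - δ) ^ 2))
    (himK : (proj5 ∘ ι) '' outerPartK ι δ (e 0) =
      Metric.closedBall 0 (Real.sqrt (1 - (1 - δ) ^ 2)) \ chimney4 D)
    (hchim : chimney4 D ⊆ Metric.ball 0 (Real.sqrt (1 - (1 - δ) ^ 2)))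
    (hCim : C '' {q : EuclideanSpace ℝ (Fin 5) | ‖q‖ = 1 ∧ q 4 ≤ 1 - δ} =
      (liftS4 '' Metric.ball 0 (Real.sqrt (1 - (1 - δ) ^ 2)))ᶜ)
    {R : ℝ} (hR : 2 ≤ R) :
    psiMap ι δ C '' {m | m ∉ e 0 '' Metric.ball 0 R} =
      (chimney D ∪ (liftS4 ∘ proj5 ∘ ι ∘ e 0) '' {u | 2 ≤ ‖u‖ ∧ ‖u‖ < R})ᶜ := by
  set ρ := Real.sqrt (1 - (1 - δ) ^ 2) with hρ
  have hN := northPole_notMem_range_liftedCrease ι (e 0)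
  -- chart points of the closed collar are in the closed outer part, with shadow in `B_ρ`
  have hcollarK : ∀ u : EuclideanSpace ℝ (Fin 4), 2 ≤ ‖u‖ → e 0 u ∈ outerPartK ι δ (e 0) := fun u hu => by
    refine ⟨(hchart u).le, ?_⟩
    rintro ⟨u', hu', hu'u⟩
    rw [he hu'u] at hu'
    exact absurd (mem_ball_zero_iff.1 hu') (not_lt.2 hu)
  have hcollar_ball : ∀ u : EuclideanSpace ℝ (Fin 4), 2 ≤ ‖u‖ → (proj5 ∘ ι ∘ e 0) u ∈ Metric.ball 0 ρ :=
    fun u hu => mem_ball_zero_iff.2 (hlt _ (hcollarK u hu) (hchart u))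
  -- a cap point goes to the complement of `λ(B_ρ)`
  have hcap : ∀ m : M, ι m 4 ≤ 1 - δ → psiMap ι δ C m ∈ (liftS4 '' Metric.ball 0 ρ)ᶜ := fun m hm => by
    rw [psiMap_of_le hm, ← hCim]
    exact mem_image_of_mem C ⟨by simpa using mem_sphere_of_apply_le hround hm, hm⟩
  -- the chimney lies in `λ(B_ρ)`
  have hchimney_ball : chimney D ⊆ liftS4 '' Metric.ball 0 ρ := fun z hz => by
    obtain ⟨y, rfl⟩ := chimney_subset_range_liftS4 D hN hz
    exact mem_image_of_mem liftS4 (hchim hz)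
  apply Subset.antisymm
  · rintro _ ⟨m, hm, rfl⟩ hmem
    by_cases hle : ι m 4 ≤ 1 - δ
    · rcases hmem with hz | ⟨u, hu, hzu⟩
      · exact hcap m hle (hchimney_ball hz)
      · refine hcap m hle ?_
        rw [← hzu]
        exact mem_image_of_mem liftS4 (hcollar_ball u hu.1)
    · have hgt : 1 - δ < ι m 4 := not_le.1 hle
      have hmK : m ∈ outerPartK ι δ (e 0) := mem_outerPartK_of_not_mem hR hm hgt.le
      have hsh : (proj5 ∘ ι) m ∈ Metric.closedBall 0 ρ \ chimney4 D := himK ▸ mem_image_of_mem _ hmK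
      rw [psiMap_of_lt hgt] at hmem
      rcases hmem with hz | ⟨u, hu, hzu⟩
      · exact hsh.2 hz
      · have heq : m = e 0 u :=
          (hinjK hmK (hcollarK u hu.1) (liftS4_injective hzu).symm)
        exact hm ⟨u, mem_ball_zero_iff.2 hu.2, heq.symm⟩
  · intro z hz
    by_cases hzb : z ∈ liftS4 '' Metric.ball 0 ρ
    · obtain ⟨y, hy, rfl⟩ := hzb
      have hy4 : y ∉ chimney4 D := fun h4 => hz (Or.inl h4)
      have hyK : y ∈ (proj5 ∘ ι) '' outerPartK ι δ (e 0) := by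
        rw [himK]
        exact ⟨ball_subset_closedBall hy, hy4⟩
      obtain ⟨m, hmK, hmy⟩ := hyK
      have hgt : 1 - δ < ι m 4 := by
        have hle : 1 - δ ≤ ι m 4 := hmK.1
        rcases hle.lt_or_eq with h | h
        · exact h
        · exfalso
          have hn := norm_shadow_of_seam hround h.symm
          have hy' := mem_ball_zero_iff.1 hy
          rw [← hmy] at hy'
          exact absurd hn hy'.ne
      refine ⟨m, fun ⟨u, hu, hum⟩ => hz (Or.inr ⟨u, ⟨?_, mem_ball_zero_iff.1 hu⟩, ?_⟩), ?_⟩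
      · by_contra hlt2
        exact hmK.2 ⟨u, mem_ball_zero_iff.2 (not_le.1 hlt2), hum⟩
      · show liftS4 (proj5 (ι (e 0 u))) = liftS4 y
        rw [hum, ← hmy]
        rfl
      · rw [psiMap_of_lt hgt, ← hmy]
        rfl
    · have hzb' : z ∈ (liftS4 '' Metric.ball 0 ρ)ᶜ := hzb
      rw [← hCim] at hzb'
      obtain ⟨q, ⟨hq1, hq4⟩, rfl⟩ := hzb'
      obtain ⟨m, rfl⟩ := mem_range_of_mem_sphere hround (by simpa using hq1) hq4
      refine ⟨m, fun ⟨u, _, hum⟩ => ?_, psiMap_of_le hq4⟩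
      have := hchart u
      rw [hum] at this
      exact absurd hq4 (not_le.2 this)

/-! ### The structure map is an immersion on `K_R` -/

variable [IsManifold (𝓡 4) ∞ M]

/-- **The structure map has injective differential at every point of `K_R`** (`R > 2`, so `K_R` misses the
fold spheres): above `(1-δ)/2` it is locally `λ ∘ proj5 ∘ ι` with `λ` an immersion and the shadow immersive
(off the fold spheres above the plane — hypothesis `hfold` —, and at round points of positive height,
`injective_mfderiv_shadow_of_le`); below the
plane it is locally `C ∘ ι`, `dι_m` is injective with range tangent to the sphere, and `dC` is injective on tangent
directions at cap points. -/
theorem injective_mfderiv_psiMap (hι : Manifold.IsSmoothEmbedding (𝓡 4) (𝓡 5) ∞ ι)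
    (hδ : 0 < δ) (hδ1 : δ < 1)
    (hround : Set.range ι ∩ {p : EuclideanSpace ℝ (Fin 5) | p 4 ≤ 1 - δ} =
      (Metric.sphere (0 : EuclideanSpace ℝ (Fin 5)) 1 : Set (EuclideanSpace ℝ (Fin 5))) ∩
        {p : EuclideanSpace ℝ (Fin 5) | p 4 ≤ 1 - δ})
    (hCs : ∀ p : EuclideanSpace ℝ (Fin 5), p 4 < 1 →
      ContMDiffAt 𝓘(ℝ, EuclideanSpace ℝ (Fin 5)) (𝓡 4) ∞ C p)
    (hCband : ∀ p : EuclideanSpace ℝ (Fin 5), ‖p‖ = 1 → (1 - δ) / 2 ≤ p 4 → p 4 < 1 →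
      C p = liftS4 (proj5 p))
    (hCd : ∀ p : EuclideanSpace ℝ (Fin 5), ‖p‖ = 1 → p 4 ≤ 1 - δ → ∀ w : EuclideanSpace ℝ (Fin 5),
      ⟪p, w⟫ = 0 → mfderiv 𝓘(ℝ, EuclideanSpace ℝ (Fin 5)) (𝓡 4) C p w = 0 → w = 0)
    {e : Fin 1 → EuclideanSpace ℝ (Fin 4) → M} {R : ℝ}
    (hfold : ∀ m : M, 1 - δ < ι m 4 → m ∉ e 0 '' Metric.ball 0 R →
      Injective (mfderiv (𝓡 4) (𝓡 4) (proj5 ∘ ι) m))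
    {m : M} (hm : m ∉ e 0 '' Metric.ball 0 R) :
    Injective (mfderiv (𝓡 4) (𝓡 4) (psiMap ι δ C) m) := by
  by_cases hband : (1 - δ) / 2 < ι m 4
  · -- locally `λ ∘ proj5 ∘ ι`
    have hopen : IsOpen {m' : M | (1 - δ) / 2 < ι m' 4} := isOpen_lt continuous_const (continuous_height hι)
    have hev : psiMap ι δ C =ᶠ[𝓝 m] liftS4 ∘ (proj5 ∘ ι) :=
      Filter.eventually_of_mem (hopen.mem_nhds hband) fun m' hm' =>
        psiMap_eq_liftS4_of_lt hround hCband hδ hm'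
    rw [hev.mfderiv_eq]
    have h1 : HasMFDerivAt (𝓡 4) (𝓡 4) (proj5 ∘ ι) m (mfderiv (𝓡 4) (𝓡 4) (proj5 ∘ ι) m) :=
      ((contMDiff_shadow hι m).mdifferentiableAt (by simp)).hasMFDerivAt
    have h2 : HasMFDerivAt (𝓡 4) (𝓡 4) liftS4 ((proj5 ∘ ι) m)
        (mfderiv (𝓡 4) (𝓡 4) liftS4 ((proj5 ∘ ι) m)) :=
      ((contMDiff_liftS4 _).mdifferentiableAt (by simp)).hasMFDerivAt
    rw [(h2.comp m h1).mfderiv]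
    have hsh : Injective (mfderiv (𝓡 4) (𝓡 4) (proj5 ∘ ι) m) := by
      by_cases hgt : 1 - δ < ι m 4
      · exact hfold m hgt hm
      · exact injective_mfderiv_shadow_of_le hι hδ hδ1 hround (by linarith) (not_lt.1 hgt)
    intro a b hab
    exact hsh (injective_mfderiv_liftS4 _ hab)
  · -- locally `C ∘ ι`
    have hlt : ι m 4 < 1 - δ := by linarith [not_lt.1 hband]
    have hopen : IsOpen {m' : M | ι m' 4 < 1 - δ} := isOpen_lt (continuous_height hι) continuous_const
    have hev : psiMap ι δ C =ᶠ[𝓝 m] C ∘ ι :=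
      Filter.eventually_of_mem (hopen.mem_nhds hlt) fun m' hm' => psiMap_of_le (le_of_lt hm')
    rw [hev.mfderiv_eq]
    have h1 : HasMFDerivAt (𝓡 4) (𝓡 5) ι m (mfderiv (𝓡 4) (𝓡 5) ι m) :=
      ((hι.contMDiff m).mdifferentiableAt (by simp)).hasMFDerivAt
    have h2 : HasMFDerivAt 𝓘(ℝ, EuclideanSpace ℝ (Fin 5)) (𝓡 4) C (ι m)
        (mfderiv 𝓘(ℝ, EuclideanSpace ℝ (Fin 5)) (𝓡 4) C (ι m)) :=
      ((hCs (ι m) (by linarith)).mdifferentiableAt (by simp)).hasMFDerivAt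
    rw [(h2.comp m h1).mfderiv]
    have hcl : m ∈ closure {m' : M | ι m' 4 < 1 - δ} := subset_closure hlt
    have hs : ‖ι m‖ = 1 := by simpa using mem_sphere_of_apply_le hround hlt.le
    intro a b hab
    apply injective_mfderiv_of_emb hι m
    set w₁ : EuclideanSpace ℝ (Fin 5) := mfderiv (𝓡 4) (𝓡 5) ι m a with hw₁
    set w₂ : EuclideanSpace ℝ (Fin 5) := mfderiv (𝓡 4) (𝓡 5) ι m b with hw₂
    have horth : ⟪ι m, w₁ - w₂⟫ = 0 := by
      rw [inner_sub_right, inner_mfderiv_eq_zero hι hround hcl a, inner_mfderiv_eq_zero hι hround hcl b,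
        sub_zero]
    have hab' : mfderiv 𝓘(ℝ, EuclideanSpace ℝ (Fin 5)) (𝓡 4) C (ι m) w₁ =
        mfderiv 𝓘(ℝ, EuclideanSpace ℝ (Fin 5)) (𝓡 4) C (ι m) w₂ := hab
    have hzero : mfderiv 𝓘(ℝ, EuclideanSpace ℝ (Fin 5)) (𝓡 4) C (ι m) (w₁ - w₂) = 0 := by
      have hms := (mfderiv 𝓘(ℝ, EuclideanSpace ℝ (Fin 5)) (𝓡 4) C (ι m)).map_sub w₁ w₂
      rw [hab', sub_self] at hms
      exact hms
    exact sub_eq_zero.1 (hCd (ι m) hs hlt.le (w₁ - w₂) horth hzero)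

end Psi

end Summit.SmoothPoincare4.SmoothPoincare4.Theorems.OrigamiFoldExistence.ShadowPleats

end
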